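import Summits.CriticalPhenomena.PercolationContinuityZ3.Theorems.PercNearOneGluingNoHeavyQuantFarSunSupportLemma
import HarnessLib

/-!
# FAR beyond trees: the support lemma in RUN form — a ghost outcome containing (or missing) a run of `≥ K − j` consecutive positions
# never uses `b` and bets only on the positions common to all windows of the run

builds on p205010 (kernel theorem, internal audit signed; external expert review pending)

Support file (`--supports stmt-CriticalPhenomena-4575`), seat `prim-cert-1` (gen 30); memo `prim-cert-1/FROM-prim-cert-1-g30-SUPPORT-LEMMA.md` §1.
This is gen 28's formulation of the support rule (`FROM-prim-cert-1-g28-TOP-LAYERS.md` §2c), derived from the window form `TK.support_lemma`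
(`…QuantFarSunSupportLemma`): with `L = K − j`, if the run `[s', e']` (`e' < K`, length `e' − s' + 1 ≥ L`) is contained in `Y` or disjoint from `Y`, then
`b(Y) = 0` and `a_k(Y) = 0` for every `k < K` outside the core `[e' + 1 − L, s' + L − 1]` of the run (i.e. `k + L ≤ e'` or `s' + L ≤ k`), because such
a `k` misses one of the two extreme windows `[s', s'+L)` and `[e'+1−L, e'+1)` of the run.
* `TK.support_rule_b`, `TK.support_rule_a`.
Elementary [this work]; no sorries, standard axioms.
-/

namespace Summit.CriticalPhenomena.PercolationContinuityZ3.Theorems.HairyCycle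

namespace TK

open Finset

variable {K j : ℕ} {a : ℕ → Finset ℕ → ℤ} {b : Finset ℕ → ℤ}

/-- **Support rule, `b`-part (run form).**  If a run `[s', e']` of length `≥ K − j` (`e' < K`) lies inside `Y` or is disjoint from `Y`, then `b(Y) = 0`. [this work] -/
theorem support_rule_b (hK : 2 * j + 1 ≤ K)
    (ha : ∀ k, ∀ R', R' ⊆ range K → 0 ≤ a k R') (hb : ∀ R', R' ⊆ range K → 0 ≤ b R')
    (hcore : ∀ l m u v : ℕ, m ≤ l → l ≤ K + 1 → u ≤ v → v ≤ K →
      ∀ Z T : Finset ℕ, Z ⊆ range K → T ⊆ range K → Disjoint Z T →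
        0 ≤ (∑ J ∈ T.powerset, Wgen K j a b (cov K l u ∩ (Z ∪ J)) (cov K m v ∩ (Z ∪ (T \ J)))) +
          ∑ J ∈ T.powerset, Wgen K j a b (cov K l v ∩ (Z ∪ J)) (cov K m u ∩ (Z ∪ (T \ J))))
    {s' e' : ℕ} (he : e' < K) (hlen : s' + (K - j) ≤ e' + 1) {Y : Finset ℕ} (hY : Y ⊆ range K)
    (hrun : Icc s' e' ⊆ Y ∨ Disjoint (Icc s' e') Y) : b Y = 0 := by
  have hs : s' ≤ j := by omega
  have hsub : Ico s' (s' + (K - j)) ⊆ Icc s' e' := fun k hk => by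
    rw [mem_Ico] at hk; rw [mem_Icc]; omega
  refine support_lemma_b hK ha hb hcore hs hY ?_
  rcases hrun with h | h
  · exact Or.inl (hsub.trans h)
  · exact Or.inr (h.mono_left hsub)

/-- **Support rule, `a`-part (run form).**  If a run `[s', e']` of length `≥ L = K − j` (`e' < K`) lies inside `Y` or is disjoint from `Y`, then
`a_k(Y) = 0` for every `k < K` off the core of the run: `k + L ≤ e'` or `s' + L ≤ k`. [this work] -/
theorem support_rule_a (hK : 2 * j + 1 ≤ K)
    (ha : ∀ k, ∀ R', R' ⊆ range K → 0 ≤ a k R') (hb : ∀ R', R' ⊆ range K → 0 ≤ b R')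
    (hcore : ∀ l m u v : ℕ, m ≤ l → l ≤ K + 1 → u ≤ v → v ≤ K →
      ∀ Z T : Finset ℕ, Z ⊆ range K → T ⊆ range K → Disjoint Z T →
        0 ≤ (∑ J ∈ T.powerset, Wgen K j a b (cov K l u ∩ (Z ∪ J)) (cov K m v ∩ (Z ∪ (T \ J)))) +
          ∑ J ∈ T.powerset, Wgen K j a b (cov K l v ∩ (Z ∪ J)) (cov K m u ∩ (Z ∪ (T \ J))))
    {s' e' : ℕ} (he : e' < K) (hlen : s' + (K - j) ≤ e' + 1) {Y : Finset ℕ} (hY : Y ⊆ range K)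
    (hrun : Icc s' e' ⊆ Y ∨ Disjoint (Icc s' e') Y) {k : ℕ} (hk : k < K)
    (hoff : k + (K - j) ≤ e' ∨ s' + (K - j) ≤ k) : a k Y = 0 := by
  -- the window to use: the right-most window of the run if `k` is left of the core, the left-most one if `k` is right of it
  obtain ⟨w, hw, hwrun, hkw⟩ : ∃ w, w ≤ j ∧ Ico w (w + (K - j)) ⊆ Icc s' e' ∧ k ∉ Ico w (w + (K - j)) := by
    rcases hoff with h | h
    · refine ⟨e' + 1 - (K - j), by omega, fun i hi => ?_, fun hm => ?_⟩
      · rw [mem_Ico] at hi; rw [mem_Icc]; omega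
      · rw [mem_Ico] at hm; omega
    · refine ⟨s', by omega, fun i hi => ?_, fun hm => ?_⟩
      · rw [mem_Ico] at hi; rw [mem_Icc]; omega
      · rw [mem_Ico] at hm; omega
  refine support_lemma_a hK ha hb hcore hw hY ?_ hk hkw
  rcases hrun with h | h
  · exact Or.inl (hwrun.trans h)
  · exact Or.inr (h.mono_left hwrun)

end TK

end Summit.CriticalPhenomena.PercolationContinuityZ3.Theorems.HairyCycle
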